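import Summits.CriticalPhenomena.PercolationContinuityZ3.Theorems.Transplant.SkelPhiWinLevels
import Summits.CriticalPhenomena.PercolationContinuityZ3.Theorems.Transplant.SkelWinPackaging
import HarnessLib

/-!
# D″ node, STRUCTURE-FREE generic layer (SHEAR-SCOPE §3.14 ruling (B″), V98; DPRIME-SCOPE L6′/L7′): ONE TARGET STEP IN A WINDOW GRAPH of a
# bare planar map `φ : V → ℤ²` from planar box data — the level data / region / step of the Φ-free record `Skel.WinStepData` read through
# `Skelφ.winLData` / `Skelφ.Win`, its `KitsAt` packaging, and `cond_j` FROM ONE WINDOW STEP for any lag-1 anchored scheme `S : KSchA V A`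
# — φ-level re-cut of the Φ-DEPENDENT declarations of `SkelWinChainT` §1 (stmt-g7, p233419) ∪ `SkelWinPackaging` §2 (`Skel.cond_of_winStep`,
# stmt-g7); the record `Skel.WinStepData` itself and the generic core `KSchA.cond_of_step` (KNCells2Face) are IMPORTED, not re-declared

builds on p205010 (kernel theorem, internal audit signed; external expert review pending) — nothing in this file uses p205010.
Lane `prim-bschramm`, seat `prim-hp-8` (gen 30; claim 2026-08-21T04:3xZ — the cell-free, schedule-free window-STEP sub-layer of the unowned
stmt column, consumed by the face residue (F) and by every packaging); helper file (`--supports stmt-CriticalPhenomena-4575`).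
Hypotheses through p3-g7's dictionary (DPRIME-SCOPE addendum K): `hlip : Skelφ.Lip G φ` only (the level nesting inside `Skelφ.lhyp_win`);
the data take `G φ` explicitly (K2.1).  Instance regime (K2.4): ONE `[DecidableEq V]` binder where `KitsAt` / `IsSubbox` need it — g29's
`Skelφ.lhyp_win` is instance-polymorphic, so the `convert` bridges of `Skel.WinStepData.kitsAt_tstep` disappear.  NOT re-cut here (design open
under D″: cells `C : PCells` and the planar schedules live in the records): `Skel.WinChainData` (§2 of `SkelWinChainT`), `Skel.hreach_of_winChain`.
* §1 `Skelφ.stepLv G φ P := Skelφ.winLData G φ P.root P.Rπ P.lo P.hi P.root P.Sfin`, `Skelφ.stepRg G φ P := Skelφ.Win G φ P.root P.Dpl P.Rπ`,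
  **`Skelφ.tstep G φ P : TStep (winGraph G P.root P.Rπ)`**, `stepLv_X`, `mem_stepRg`, `tstep_o/_T/_D/_L`, `stepLv_encl_of_planar`,
  `Win_subset_stepLv_X_zero`, **`kitsAt_tstep (hlip)`**;
* §2 **`Skelφ.cond_of_winStep (hlip)`** — one window step whose first level contains the face `F^{j+1}`, true target `T' ⊆ M^{a'}_{x+du}` inside
  the enlarged target, excess `≤ η ≤ δc/2`, turns `1 - δ₂ < P_{Wt}(root ↔ F^{j+1})` into `cond` (over `KSchA.cond_of_step` at `G' := winGraph G root Rπ`);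
* §3 bridges (`rfl`): `Skel.WinStepData.Lv_eq_skelφ / Rg_eq_skelφ / tstep_eq_skelφ`.
Call sites port from `Skel.WinStepData.*` by `P.Lv Φ ↦ Skelφ.stepLv G φ P`, `P.Rg Φ ↦ Skelφ.stepRg G φ P`, `P.tstep Φ ↦ Skelφ.tstep G φ P`,
`kitsAt_tstep Φ ↦ Skelφ.kitsAt_tstep hlip`, `cond_of_winStep Φ P ↦ Skelφ.cond_of_winStep hlip P` (K2.2).
[cite: KozmaNitzan2024, §4 Lemma 10 (p. 17), p. 15 (B⟨j⟩), p. 30 (Step III)]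
-/

noncomputable section

open MeasureTheory ProbabilityTheory
open scoped ENNReal

namespace Summit.CriticalPhenomena.PercolationContinuityZ3.Theorems.Transplant

namespace Skelφ

open Literature.Probability.Percolation Literature.Probability.LatticeModels SimpleGraph
open Literature.Probability.Percolation.KozmaNitzan
open KNLevels KNCells
open Skel (winGraph WinStepData)

open scoped Classical

variable {V : Type} (G : SimpleGraph V) [G.LocallyFinite] (φ : V → Site 2)

/-! ## §1 One step from planar box data -/

/-- **The level data of the window step `P`**: the window levels of the planar box `[lo, hi]` about the window centre `root` (φ-level form of
`Skel.WinStepData.Lv`). [this work] -/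
def stepLv (P : WinStepData V) : LData (winGraph G P.root P.Rπ) := winLData G φ P.root P.Rπ P.lo P.hi P.root P.Sfin

/-- **The region of the window step `P`**: `Win root Dpl Rπ` (φ-level form of `Skel.WinStepData.Rg`). [this work] -/
def stepRg (P : WinStepData V) : Finset V := Win G φ P.root P.Dpl P.Rπ

/-- **The step** as a `KNLevels.TStep` of the window graph (φ-level form of `Skel.WinStepData.tstep`). [this work] -/
def tstep (P : WinStepData V) : TStep (winGraph G P.root P.Rπ) := ⟨stepLv G φ P, stepRg G φ P, P.T, P.Rlev, P.N, P.j₀, P.j₁⟩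

/-- The levels: `X_k = Win root [lo - k, hi + k] Rπ`. [cite: KozmaNitzan2024, §4 p. 15 (B⟨j⟩)] -/
theorem stepLv_X (P : WinStepData V) (k : ℕ) :
    (stepLv G φ P).X k = Win G φ P.root (Finset.Icc (P.lo - (k : Site 2)) (P.hi + (k : Site 2))) P.Rπ := rfl

/-- Membership in the region. [folklore] -/
theorem mem_stepRg (P : WinStepData V) {v : V} : v ∈ stepRg G φ P ↔ v ∈ Win G φ P.root P.Dpl P.Rπ := Iff.rfl

/-- The level data of the step. [folklore] -/
theorem tstep_L (P : WinStepData V) : (tstep G φ P).L = stepLv G φ P := rfl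

/-- The source of the step. [folklore] -/
theorem tstep_o (P : WinStepData V) : (tstep G φ P).L.o = P.root := rfl

/-- The target of the step. [folklore] -/
theorem tstep_T (P : WinStepData V) : (tstep G φ P).T = P.T := rfl

/-- The region of the step. [folklore] -/
theorem tstep_D (P : WinStepData V) : (tstep G φ P).D = Win G φ P.root P.Dpl P.Rπ := rfl

/-- **`X_{Rlev+1} ⊆ D`** from the planar containment. [cite: KozmaNitzan2024, §4 Lemma 10 (p. 17: B⟨R+1⟩ ⊆ D)] -/
theorem stepLv_encl_of_planar {P : WinStepData V}
    (h : Finset.Icc (P.lo - ((P.Rlev + 1 : ℕ) : Site 2)) (P.hi + ((P.Rlev + 1 : ℕ) : Site 2)) ⊆ P.Dpl) :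
    (stepLv G φ P).X (P.Rlev + 1) ⊆ stepRg G φ P := by
  rw [stepLv_X]; exact Win_mono G φ h le_rfl

/-- **A window over a planar subset of the box, of depth at most `Rπ`, lies in `X_0`** (for `hface : Face^{j+1} ⊆ X_0` and for the wired root
seed). [folklore] -/
theorem Win_subset_stepLv_X_zero {P : WinStepData V} {R' : ℕ} {Pl : Finset (Site 2)} (hR : R' ≤ P.Rπ) (hPl : Pl ⊆ Finset.Icc P.lo P.hi) :
    Win G φ P.root Pl R' ⊆ (stepLv G φ P).X 0 := by
  rw [stepLv_X]
  refine Win_mono G φ ?_ hR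
  simpa using hPl

variable {G φ}

/-- **`KitsAt` of the step** (from `Lip`) from a subbox region in the window graph, finite support, the source off the region, the planar
enclosure, `T ⊆ D` nonempty, the count inequality and the per-level kit clause — at the ambient `DecidableEq` (no instance bridge).
[cite: KozmaNitzan2024, §4 Lemma 10 (p. 17)] -/
theorem kitsAt_tstep [DecidableEq V] (hlip : Lip G φ) {P : WinStepData V} {Wt : Sym2 V → unitInterval}
    {p : unitInterval} {Δ : ℕ} {δ : ℝ}
    (hsub : IsSubbox (winGraph G P.root P.Rπ) Wt p (stepRg G φ P)) (hfin : FinSupp Wt P.Sfin) (hDS : stepRg G φ P ⊆ P.Sfin)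
    (hencl : Finset.Icc (P.lo - ((P.Rlev + 1 : ℕ) : Site 2)) (P.hi + ((P.Rlev + 1 : ℕ) : Site 2)) ⊆ P.Dpl)
    (ho : P.root ∉ stepRg G φ P) (hoS : P.root ∈ P.Sfin) (hj : P.j₁ ≤ P.Rlev) (hTD : P.T ⊆ stepRg G φ P) (hTne : P.T.Nonempty)
    (hcount : 1 / (1 - (p : ℝ)) ^ (Δ * P.N) ≤ δ * ((Finset.Icc P.j₀ P.j₁).card : ℝ))
    (hkits : ∀ j ∈ Finset.Icc P.j₀ P.j₁, ∃ (σ : SData V) (S : Finset V),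
      SHyp (winLData G φ P.root P.Rπ P.lo P.hi P.root P.Sfin) j σ ∧ σ.N ≤ P.N ∧
      (1 - (p : ℝ) ^ σ.sB) ^ σ.k ≤ δ ∧ S ⊆ (winLData G φ P.root P.Rπ P.lo P.hi P.root P.Sfin).X j ∧ S ⊆ stepRg G φ P ∧
      (∀ x ∈ σ.K, ∀ e ∈ σ.seed x, e ∉ wireSet (↑S : Set V)) ∧ (∀ x ∈ σ.K, σ.face x ⊆ S) ∧
      (∀ x ∈ σ.K, 1 - 3 * δ ≤ (prodBernoulli Wt).real {ω | ∃ u ∈ σ.face x,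
        1 - δ < (prodBernoulli (pinW Wt (wireSet (↑S : Set V)) ω)).real (⋃ t ∈ P.T, openConnIn (↑(stepRg G φ P) : Set V) u t)})) :
    (tstep G φ P).KitsAt Wt p Δ δ :=
  ⟨lhyp_win hlip P.root P.Rπ P.lo P.hi hsub hfin hDS (stepLv_encl_of_planar G φ hencl) ho hoS, hj, hTD, hTne, hcount, hkits⟩

/-! ## §2 `cond_j` from one window step -/

open GadgetSystem ProbeHistory HSiteScheme Contour

/-- **`cond_j` FROM ONE WINDOW STEP** (generic design (D): the face input; from `Lip`): one window step `P` rooted at the scheme's root whose first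
level contains the face `F^{j+1}`, with the subbox / support facts of the law `Wt`, Step II's count at accuracy `δ₂`, the per-level kit clause at
accuracy `δ₂`, a true target `T' ⊆ M^{a'}_{x+du}` inside the enlarged target with rim excess `≤ η ≤ δc/2`, the generic one-step property of the
window graph and the source bound `1 - δ₂ < P_{Wt}(root ↔ F^{j+1})` gives `cond` (φ-level form of `Skel.cond_of_winStep`).
[cite: KozmaNitzan2024, §4 p. 30 (Step III), Lemma 10 (p. 17)] -/
theorem cond_of_winStep [DecidableEq V] (hlip : Lip G φ) {A : Type*} {S : KSchA V A} {FD : FaceData V A}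
    {h : ProbeHistory V} {e : Site 2 × MDir} {a a' : A} {du : MDir} (P : WinStepData V) {j : ℕ} {o : Finset (Sym2 V)} {Δ' : ℕ}
    {δ₂ η : ℝ}
    (hstep : ∀ (Wg : Sym2 V → unitInterval) (s : TStep (winGraph G P.root P.Rπ)), s.KitsAt Wg S.p Δ' δ₂ →
      1 - δ₂ < (prodBernoulli Wg).real s.L.reachB → 1 - S.δc / 2 < (prodBernoulli Wg).real (⋃ t ∈ s.T, openConn s.L.o t))
    (hroot : P.root = S.Γ.root)
    (hsub : IsSubbox (winGraph G P.root P.Rπ) (S.Wt G h e a a' du j o) S.p (stepRg G φ P))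
    (hfin : FinSupp (S.Wt G h e a a' du j o) P.Sfin) (hDS : stepRg G φ P ⊆ P.Sfin)
    (hencl : Finset.Icc (P.lo - ((P.Rlev + 1 : ℕ) : Site 2)) (P.hi + ((P.Rlev + 1 : ℕ) : Site 2)) ⊆ P.Dpl)
    (ho : P.root ∉ stepRg G φ P) (hoS : P.root ∈ P.Sfin) (hj : P.j₁ ≤ P.Rlev) (hTD : P.T ⊆ stepRg G φ P) (hTne : P.T.Nonempty)
    (hcount : 1 / (1 - (S.p : ℝ)) ^ (Δ' * P.N) ≤ δ₂ * ((Finset.Icc P.j₀ P.j₁).card : ℝ))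
    (hkits : ∀ j' ∈ Finset.Icc P.j₀ P.j₁, ∃ (σ : SData V) (Sz : Finset V),
      SHyp (winLData G φ P.root P.Rπ P.lo P.hi P.root P.Sfin) j' σ ∧ σ.N ≤ P.N ∧
      (1 - (S.p : ℝ) ^ σ.sB) ^ σ.k ≤ δ₂ ∧ Sz ⊆ (winLData G φ P.root P.Rπ P.lo P.hi P.root P.Sfin).X j' ∧ Sz ⊆ stepRg G φ P ∧
      (∀ x ∈ σ.K, ∀ e' ∈ σ.seed x, e' ∉ wireSet (↑Sz : Set V)) ∧ (∀ x ∈ σ.K, σ.face x ⊆ Sz) ∧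
      (∀ x ∈ σ.K, 1 - 3 * δ₂ ≤ (prodBernoulli (S.Wt G h e a a' du j o)).real {ω | ∃ u ∈ σ.face x,
        1 - δ₂ < (prodBernoulli (pinW (S.Wt G h e a a' du j o) (wireSet (↑Sz : Set V)) ω)).real
          (⋃ t ∈ P.T, openConnIn (↑(stepRg G φ P) : Set V) u t)}))
    (T' : Finset V) (hT' : T' ⊆ P.T) (hT'M : T' ⊆ S.Γ.M a' (tgt e + stepVec du))
    (hexc : (prodBernoulli (S.Wt G h e a a' du j o)).real (⋃ t ∈ P.T \ T', openConn S.Γ.root t) ≤ η) (hη : η ≤ S.δc / 2)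
    (hface : FD.Face a' (tgt e) du (j + 1) ⊆ (stepLv G φ P).X 0)
    (hsrc : 1 - δ₂ < (prodBernoulli (S.Wt G h e a a' du j o)).real
      (⋃ b ∈ FD.Face a' (tgt e) du (j + 1), openConn S.Γ.root b)) :
    S.cond G h e a a' du j o :=
  KSchA.cond_of_step (winGraph G P.root P.Rπ) hstep (tstep G φ P) (by rw [tstep_o, hroot])
    (kitsAt_tstep hlip hsub hfin hDS hencl ho hoS hj hTD hTne hcount hkits) T' hT' hT'M hexc hη hface hsrc

end Skelφ

/-! ## §3 Bridges: the structure-level step data are the φ-level ones (by `rfl`) -/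

namespace Skel.WinStepData

open Literature.Probability.LatticeModels

variable {V : Type} {G : SimpleGraph V} [G.LocallyFinite] (Φ : PlanarSkeletonConc G) (P : WinStepData V)

/-- `P.Lv Φ` is the φ-level `Skelφ.stepLv G Φ.φ P`. [folklore] -/
theorem Lv_eq_skelφ : P.Lv Φ = Skelφ.stepLv G Φ.φ P := rfl

/-- `P.Rg Φ` is the φ-level `Skelφ.stepRg G Φ.φ P`. [folklore] -/
theorem Rg_eq_skelφ : P.Rg Φ = Skelφ.stepRg G Φ.φ P := rfl

/-- `P.tstep Φ` is the φ-level `Skelφ.tstep G Φ.φ P`. [folklore] -/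
theorem tstep_eq_skelφ : P.tstep Φ = Skelφ.tstep G Φ.φ P := rfl

end Skel.WinStepData

end Summit.CriticalPhenomena.PercolationContinuityZ3.Theorems.Transplant

end
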